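import Literature.AlgebraicGeometry.Motives.SubschemeCycles
import HarnessLib

/-!
# Slices at rational points: the `Spec K`-point and the `𝟙`-point spellings

Layer `Literature/AlgebraicGeometry/Motives`, namespace `Literature.AlgebraicGeometry.Motives`. THEOREMS ONLY; no named fact,
no instance, no notation. Cell `hodgecm-mathlib` (D-0151), M1PRIME-DAG rung 0, J0b road (i) glue (P-c) between the two spellings
of a rational point of a `K`-scheme `T` that the tree uses side by side:

* `t : AlgPoints T K`, i.e. `t : specOver K K ⟶ T` (★ `Motives/AlgPoints`; slices written `lift (𝟙 X) (toSpecOver X ≫ t)`,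
  as in ★ `AbelianVarieties/PoincareSheafSlices`, ★ `…SlicesPoints`, ★ `…SeesawFibre`), and
* `t₀ : 𝟙_ (SchemeOver K) ⟶ T` (slices written `(ρ_ X).inv ≫ X ◁ t₀`, as in ★ `Motives/SeesawTrivialLocusRationalPoint`,
  ★ `Motives/TheoremOfCubeThickenings`).

The two sources `specOver K K` and `𝟙_ (SchemeOver K)` have the same underlying scheme `Spec K` but different (equal, not
syntactically) structure maps, so the passage is `Over.homMk t.left _` in either direction; the lemmas below are stated
against ANY pair `(t, t₀)` with `t₀.left = t.left`, so that no new definition is needed.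

* `toUnit_comp_eq_toSpecOver_comp` — `toUnit X ≫ t₀ = toSpecOver X ≫ t`;
* `lift_id_toSpecOver_comp_eq_slice` — `lift (𝟙 X) (toSpecOver X ≫ t) = (ρ_ X).inv ≫ X ◁ t₀`;
* `AlgPoints.pt_eq_base_apply` / `AlgPoints.pt_eq_base_of_left_eq` — the underlying point `t.pt` is `t.left.base s = t₀.left.base s`
  for every `s : Spec K` (the glue between ★ `Motives.eq_univ_of_isClosed_of_forall_pt_mem` and the `t₀.left s` of ★
  `mem_trivialLocus_iff_classPullback_slice_linEquiv_zero`).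

Banked capital; HC_CM is proved only modulo the 7 printed citations until rung 0 closes.

## References

* [Hartshorne1977] R. Hartshorne, *Algebraic Geometry*, II Ex. 2.7 (rational points as sections `Spec K → X` over `K`).
* [GortzWedhorn2020] U. Görtz, T. Wedhorn, *Algebraic Geometry I* (2nd ed.), §4.1 and (5.1.1) (`X(K)` and slices `X × {t}`).
-/

noncomputable section

open CategoryTheory AlgebraicGeometry MonoidalCategory CartesianMonoidalCategory

universe u

namespace Literature.AlgebraicGeometry.Motives

variable {K : Type u} [Field K] (X : SchemeOver K) {T : SchemeOver K}

/-- `toUnit X ≫ t₀ = toSpecOver X ≫ t` whenever `t₀` and `t` have the same underlying morphism `Spec K → T` (the constant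
`X`-point at `t`). [cite: Hartshorne1977, II Ex. 2.7] -/
theorem toUnit_comp_eq_toSpecOver_comp (t : AlgPoints T K) (t₀ : 𝟙_ (SchemeOver K) ⟶ T) (ht : t₀.left = t.left) :
    toUnit X ≫ t₀ = toSpecOver X ≫ t := by
  ext1
  rw [Over.comp_left, Over.comp_left, Over.toUnit_left, toSpecOver_left]
  exact congrArg (fun f => X.hom ≫ f) ht

/-- **The two slice spellings agree**: `(𝟙_X, t) = (ρ_X)⁻¹ ≫ X ◁ t₀ : X ⟶ X × T` whenever `t₀.left = t.left`.
[cite: GortzWedhorn2020, (5.1.1) (the slice X × {t})] -/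
theorem lift_id_toSpecOver_comp_eq_slice (t : AlgPoints T K) (t₀ : 𝟙_ (SchemeOver K) ⟶ T) (ht : t₀.left = t.left) :
    lift (𝟙 X) (toSpecOver X ≫ t) = (ρ_ X).inv ≫ X ◁ t₀ := by
  refine CartesianMonoidalCategory.hom_ext _ _ ?_ ?_
  · rw [lift_fst, Category.assoc, whiskerLeft_fst, rightUnitor_inv_fst]
  · rw [lift_snd, Category.assoc, whiskerLeft_snd, rightUnitor_inv_snd_assoc, toUnit_comp_eq_toSpecOver_comp X t t₀ ht]

/-- The same with underlying scheme morphisms (the form module pull-backs are taken along).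
[cite: GortzWedhorn2020, (5.1.1) (the slice X × {t})] -/
theorem lift_id_toSpecOver_comp_left_eq_slice_left (t : AlgPoints T K) (t₀ : 𝟙_ (SchemeOver K) ⟶ T)
    (ht : t₀.left = t.left) : (lift (𝟙 X) (toSpecOver X ≫ t)).left = ((ρ_ X).inv ≫ X ◁ t₀).left := by
  rw [lift_id_toSpecOver_comp_eq_slice X t t₀ ht]

variable {X}

/-- The underlying point of a `K`-point `t : Spec K → X` is the image of any (the) point of `Spec K` (★
`AlgPoints.pt_eq_base` of `Motives/HirschowitzIyerCurveData` is the `closedPoint` instance, by `rfl`). [cite: Hartshorne1977, II Ex. 2.7] -/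
theorem AlgPoints.pt_eq_base_apply (t : AlgPoints X K) (s : ↥(Spec (.of K))) : t.pt = t.left.base s := by
  obtain rfl : s = IsLocalRing.closedPoint K := Subsingleton.elim _ _
  rfl

/-- Hence `t.pt = t₀.left.base s` for every `s : Spec K` whenever `t₀.left = t.left` (glue between the `AlgPoints` form of
Jacobson density and the `𝟙 ⟶ T` form of the seesaw slice criterion). [cite: Hartshorne1977, II Ex. 2.7] -/
theorem AlgPoints.pt_eq_base_of_left_eq (t : AlgPoints X K) (t₀ : 𝟙_ (SchemeOver K) ⟶ X) (ht : t₀.left = t.left)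
    (s : ↥(Spec (.of K))) : t.pt = t₀.left.base s := by
  rw [ht]
  exact t.pt_eq_base_apply s

/-- Conversely every `t₀ : 𝟙 ⟶ X` HAS an `AlgPoints` partner with the same underlying morphism (so the `∀ t : AlgPoints X K`
and `∀ t₀ : 𝟙_ ⟶ X` forms of a statement about underlying morphisms are interchangeable). [cite: Hartshorne1977, II Ex. 2.7] -/
theorem exists_algPoints_left_eq (t₀ : 𝟙_ (SchemeOver K) ⟶ X) : ∃ t : AlgPoints X K, t.left = t₀.left :=
  ⟨AlgPoints.mk t₀.left (by
    have h := Over.w t₀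
    rw [Over.tensorUnit_hom] at h
    rw [Algebra.algebraMap_self, CommRingCat.ofHom_id, Spec.map_id]
    exact h), rfl⟩

/-- … and every `t : AlgPoints X K` has a `𝟙 ⟶ X` partner. [cite: Hartshorne1977, II Ex. 2.7] -/
theorem exists_unitHom_left_eq (t : AlgPoints X K) : ∃ t₀ : 𝟙_ (SchemeOver K) ⟶ X, t₀.left = t.left :=
  ⟨Over.homMk t.left (by
    rw [Over.tensorUnit_hom]
    have h : t.left ≫ X.hom = Spec.map (CommRingCat.ofHom (algebraMap K K)) := Over.w t
    rw [Algebra.algebraMap_self, CommRingCat.ofHom_id, Spec.map_id] at h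
    exact h), rfl⟩

end Literature.AlgebraicGeometry.Motives

end
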